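import Summits.ResolutionOfSingularities.ResolutionOfSingularities.Theorems.FrobeniusLadderFInjectiveMacaulayficationRMonoidDefs
import Summits.ResolutionOfSingularities.ResolutionOfSingularities.Theorems.WildQuotientsWildQuotientResolutionToricChartWords
import HarnessLib

/-!
# T-TOR IN-HOUSE for the recurrent-monoid bed: the INEQUALITY DESCRIPTION of `R` and its saturation (SAT′)
# (crux `FInjectiveMacaulayfication` stmt-ResolutionOfSingularities-15315, chain w45a; res-L1-w45a-plan-1 RULING R23.13 (2) + ADDENDUM;
# seat res-L1-w45a-lead-1 g13, CHECKPOINT 06:28Z: «ℕD = {v ∈ ℕ⁴ : a+c+e ≥ 2b, a+e ≥ b, c+e ≥ b}»)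

[OURS · L1 W4.5a] Support file (`--supports stmt-ResolutionOfSingularities-15315 --as helper`); def-free; UNCONDITIONAL; no named fact;
NOT a statement of any manuscript; replaces the role of NO printed item. AI-written (AI review is weaker than expert review). Nothing of
the crux is proved here.

THE BED `U_R = Spec k[R]`, `k[R] = ToricChart.Ring k P RMonoidDefs.rDatum ≅ k[x₁, x₃, x₄, x₂x₃x₄, x₂x₄², x₁x₂x₄, x₁x₂x₃] ⊂ k[x₁,x₂,x₃,x₄]`.
Writing `(a,b,c,e)` for the exponents of `(x₁,x₂,x₃,x₄)`:
* `wordExp_rDatum` — the exponent of a word in closed form;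
* `ineq_of_word` — every word exponent satisfies the three facet inequalities `2b ≤ a+c+e`, `b ≤ a+e`, `b ≤ c+e` (the other four facets
  of the cone are the coordinate hyperplanes; lead-1 g13 `comp/tri.py`: the cone of `R` has exactly these 7 facets and 7 extreme rays);
* ★ `exists_word_of_ineq` — conversely EVERY `(a,b,c,e) ∈ ℕ⁴` satisfying them is a word exponent (induction on `b`: subtract `x₁x₂x₃` if
  `a, c ≥ 1`; if `a = 0` subtract `x₂x₃x₄` when `c ≥ 1`, else `x₂x₄²`; if `c = 0` subtract `x₁x₂x₄`) — so `ℕD = cone(R) ∩ ℤ⁴ ∩ ℕ⁴`: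
  the Hilbert-basis / normality statement for this bed, in the kernel;
* ★★ `rDatum_saturated` — (SAT′) of `…ToricRingSplitting`: if `n ∣ wordExp rDatum w` coordinatewise (`n ≥ 1`) then
  `wordExp rDatum w = n • wordExp rDatum w′` for a word `w′` (the inequalities are homogeneous). With ✓/⧗`ToricRingSplitting.exists_split_toricRing`
  this makes `k[R]` F-split for every field `k` of characteristic `p`, hence every ideal of every local ring of `U_R` Frobenius closed.
[folklore; cite: CoxLittleSchenck2011, §1.2 (context: saturated affine semigroups)]
-/

-- single-problem summit: the doubled namespace component is forced
set_option linter.dupNamespace false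

noncomputable section

namespace Summit.ResolutionOfSingularities.ResolutionOfSingularities.Theorems.FInjectiveMacaulayfication.RMonoidSaturated

open Summit.ResolutionOfSingularities.ResolutionOfSingularities.Theorems.FInjectiveMacaulayfication
open Summit.ResolutionOfSingularities.ResolutionOfSingularities.Theorems.WildQuotientResolution.ToricChart

/-! ## §1 Word exponents of `rDatum` -/

/-- The `x₁`-exponent of a word. [OURS · computation] -/
theorem wordExp_rDatum_zero (w : Word 4 4) : wordExp RMonoidDefs.rDatum w 0 = w.wp 0 + w.wm 2 + w.wm 3 := by
  simp [wordExp, RMonoidDefs.rDatum, fsum]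
  ring

/-- The `x₂`-exponent of a word. [OURS · computation] -/
theorem wordExp_rDatum_one (w : Word 4 4) : wordExp RMonoidDefs.rDatum w 1 = w.wm 0 + w.wm 1 + w.wm 2 + w.wm 3 := by
  simp [wordExp, RMonoidDefs.rDatum, fsum]
  ring

/-- The `x₃`-exponent of a word. [OURS · computation] -/
theorem wordExp_rDatum_two (w : Word 4 4) : wordExp RMonoidDefs.rDatum w 2 = w.wp 2 + w.wm 0 + w.wm 3 := by
  simp [wordExp, RMonoidDefs.rDatum, fsum]
  ring

/-- The `x₄`-exponent of a word. [OURS · computation] -/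
theorem wordExp_rDatum_three (w : Word 4 4) : wordExp RMonoidDefs.rDatum w 3 = w.wp 3 + w.wm 0 + 2 * w.wm 1 + w.wm 2 := by
  simp [wordExp, RMonoidDefs.rDatum, fsum]
  ring

/-- **Every word exponent satisfies the three facet inequalities** `2b ≤ a+c+e`, `b ≤ a+e`, `b ≤ c+e`. [OURS · computation] -/
theorem ineq_of_word (w : Word 4 4) :
    2 * wordExp RMonoidDefs.rDatum w 1 ≤ wordExp RMonoidDefs.rDatum w 0 + wordExp RMonoidDefs.rDatum w 2 + wordExp RMonoidDefs.rDatum w 3 ∧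
    wordExp RMonoidDefs.rDatum w 1 ≤ wordExp RMonoidDefs.rDatum w 0 + wordExp RMonoidDefs.rDatum w 3 ∧
    wordExp RMonoidDefs.rDatum w 1 ≤ wordExp RMonoidDefs.rDatum w 2 + wordExp RMonoidDefs.rDatum w 3 := by
  rw [wordExp_rDatum_zero, wordExp_rDatum_one, wordExp_rDatum_two, wordExp_rDatum_three]
  omega

/-! ## §2 The Hilbert basis statement: the inequalities characterise the word exponents -/

/-- A word with prescribed exponent from pure multiplicities `a, c, e` and mixed multiplicities `m`. [plumbing] -/
theorem wordExp_mk (a c e : ℕ) (m : Fin 4 → ℕ) :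
    wordExp RMonoidDefs.rDatum ⟨![a, 0, c, e], m⟩ =
      ![a + m 2 + m 3, m 0 + m 1 + m 2 + m 3, c + m 0 + m 3, e + m 0 + 2 * m 1 + m 2] := by
  funext s
  fin_cases s
  · simp [wordExp_rDatum_zero]
  · simp [wordExp_rDatum_one]
  · simp [wordExp_rDatum_two]
  · simp [wordExp_rDatum_three]

/-- ★ **The inequality description of `R`**: every `(a,b,c,e) ∈ ℕ⁴` with `2b ≤ a+c+e`, `b ≤ a+e`, `b ≤ c+e` is the exponent of a word
(induction on `b`). Together with `ineq_of_word`: `ℕ⟨x₁, x₃, x₄, x₂x₃x₄, x₂x₄², x₁x₂x₄, x₁x₂x₃⟩ = {v ∈ ℕ⁴ : the three inequalities}`.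
[OURS · L1 W4.5a; folklore (Hilbert basis of a 4-dimensional cone)] -/
theorem exists_word_of_ineq : ∀ (b a c e : ℕ), 2 * b ≤ a + c + e → b ≤ a + e → b ≤ c + e →
    ∃ w : Word 4 4, wordExp RMonoidDefs.rDatum w = ![a, b, c, e] := by
  intro b
  induction b with
  | zero =>
    intro a c e _ _ _
    exact ⟨⟨![a, 0, c, e], ![0, 0, 0, 0]⟩, by rw [wordExp_mk]; simp⟩
  | succ b ih =>
    intro a c e h1 h2 h3
    by_cases hac : 1 ≤ a ∧ 1 ≤ c
    · -- subtract `x₁x₂x₃ = (1,1,1,0)` (mixed symbol 3)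
      obtain ⟨w₀, hw₀⟩ := ih (a - 1) (c - 1) e (by omega) (by omega) (by omega)
      refine ⟨addW w₀ (mixedWord 3), ?_⟩
      rw [wordExp_addW, hw₀]
      funext s
      fin_cases s <;> simp [wordExp_mixedWord, RMonoidDefs.rDatum] <;> omega
    · by_cases ha : a = 0
      · subst ha
        by_cases hc : 1 ≤ c
        · -- subtract `x₂x₃x₄ = (0,1,1,1)` (mixed symbol 0)
          obtain ⟨w₀, hw₀⟩ := ih 0 (c - 1) (e - 1) (by omega) (by omega) (by omega)
          refine ⟨addW w₀ (mixedWord 0), ?_⟩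
          rw [wordExp_addW, hw₀]
          funext s
          fin_cases s <;> simp [wordExp_mixedWord, RMonoidDefs.rDatum] <;> omega
        · -- `c = 0`: subtract `x₂x₄² = (0,1,0,2)` (mixed symbol 1)
          obtain ⟨w₀, hw₀⟩ := ih 0 0 (e - 2) (by omega) (by omega) (by omega)
          refine ⟨addW w₀ (mixedWord 1), ?_⟩
          rw [wordExp_addW, hw₀]
          funext s
          fin_cases s <;> simp [wordExp_mixedWord, RMonoidDefs.rDatum] <;> omega
      · -- `a ≥ 1`, `c = 0`: subtract `x₁x₂x₄ = (1,1,0,1)` (mixed symbol 2)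
        have hc : c = 0 := by omega
        subst hc
        obtain ⟨w₀, hw₀⟩ := ih (a - 1) 0 (e - 1) (by omega) (by omega) (by omega)
        refine ⟨addW w₀ (mixedWord 2), ?_⟩
        rw [wordExp_addW, hw₀]
        funext s
        fin_cases s <;> simp [wordExp_mixedWord, RMonoidDefs.rDatum] <;> omega

/-- The same with the exponent given as a function `v : Fin 4 → ℕ`. [OURS · L1 W4.5a] -/
theorem exists_word_of_ineq' (v : Fin 4 → ℕ) (h1 : 2 * v 1 ≤ v 0 + v 2 + v 3) (h2 : v 1 ≤ v 0 + v 3) (h3 : v 1 ≤ v 2 + v 3) :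
    ∃ w : Word 4 4, wordExp RMonoidDefs.rDatum w = v := by
  obtain ⟨w, hw⟩ := exists_word_of_ineq (v 1) (v 0) (v 2) (v 3) h1 h2 h3
  refine ⟨w, ?_⟩
  rw [hw]
  funext s
  fin_cases s <;> rfl

/-! ## §3 Saturation (SAT′) -/

/-- ★★ **(SAT′) for the recurrent-monoid bed**: if `n ≥ 1` divides a word exponent coordinatewise, the quotient is again a word exponent
(the facet inequalities are homogeneous). This is the hypothesis of `ToricRingSplitting.exists_split_toricRing` /
`fClause_localization_toricRing` for `D = rDatum`: `k[R]` is F-split and every ideal of every local ring of `U_R` is Frobenius closed,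
for every field `k` of characteristic `p`. [OURS · L1 W4.5a] -/
theorem rDatum_saturated (n : ℕ) (hn : 0 < n) (w : Word 4 4) (hdiv : ∀ s, n ∣ wordExp RMonoidDefs.rDatum w s) :
    ∃ w' : Word 4 4, ∀ s, wordExp RMonoidDefs.rDatum w s = n * wordExp RMonoidDefs.rDatum w' s := by
  choose q hq using hdiv
  obtain ⟨h1, h2, h3⟩ := ineq_of_word w
  have hq0 := hq 0
  have hq1 := hq 1
  have hq2 := hq 2
  have hq3 := hq 3
  have h1' : 2 * q 1 ≤ q 0 + q 2 + q 3 := by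
    have : n * (2 * q 1) ≤ n * (q 0 + q 2 + q 3) := by nlinarith
    exact Nat.le_of_mul_le_mul_left this hn
  have h2' : q 1 ≤ q 0 + q 3 := by
    have : n * q 1 ≤ n * (q 0 + q 3) := by nlinarith
    exact Nat.le_of_mul_le_mul_left this hn
  have h3' : q 1 ≤ q 2 + q 3 := by
    have : n * q 1 ≤ n * (q 2 + q 3) := by nlinarith
    exact Nat.le_of_mul_le_mul_left this hn
  obtain ⟨w', hw'⟩ := exists_word_of_ineq' q h1' h2' h3'
  exact ⟨w', fun s => by rw [hw', hq s]⟩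

/-- (SAT′) in the letter of `ToricRingSplitting.exists_split_toricRing` (prime `p`). [OURS · L1 W4.5a] -/
theorem rDatum_saturated_prime (p : ℕ) [hp : Fact p.Prime] (w : Word 4 4) (hdiv : ∀ s, p ∣ wordExp RMonoidDefs.rDatum w s) :
    ∃ w' : Word 4 4, ∀ s, wordExp RMonoidDefs.rDatum w s = p * wordExp RMonoidDefs.rDatum w' s :=
  rDatum_saturated p hp.out.pos w hdiv

end Summit.ResolutionOfSingularities.ResolutionOfSingularities.Theorems.FInjectiveMacaulayfication.RMonoidSaturated

end
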